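import Summits.BirchSwinnertonDyer.BirchSwinnertonDyer.Theorems.AlignedTransportAtTwoMainConjectureTransportAlignedAtTwoAddTwistTame
import Literature.NumberTheory.EllipticCurves.PAdicLFunctionQuadraticTwistBirchProofs
import HarnessLib

/-!
# Route `AlignedTransportAtTwo`, crux C1 `MainConjectureTransportAlignedAtTwo` (stmt-BirchSwinnertonDyer-22296), line `birth` —
# the BOTH-ADDITIVE twist sub-cell, part 2c (COMPOSITE TAME LEVEL): the character halves of the tame measure at level
# `m = m'·ℓ` with `ℓ² ∣ N`, `a_ℓ = 0` and `gcd(m', N) = 1` are `½ℤ₂`-valued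

HONEST FRAMING (cell `bsd-f1-sign2`, WIDTH-5 attach seat `bsd-line-att-p4` g9, under the lead `bsd-line-att-p1`). BSD is NOT
proved; C1 is NOT closed. THEOREMS ONLY; nothing asserted; `--supports stmt-BirchSwinnertonDyer-22296 --as helper`. Sequel of
`…AddTwistTame` (the prime tame level `ℓ`). PURPOSE: the lead's walk engine (`…TwistReach`) carries a both-additive prime
`ℓ ≡ 3 (mod 4)` only through a leg `u = ℓ·q` with an auxiliary good prime `q ≡ 3 (mod 4)`; that leg lives at the COMPOSITE tame
level `m = q·ℓ`. Here `m'` is any level prime to `2N` (the good auxiliary part) and `ℓ` the both-additive prime.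

* §1 the tame fraction `c/(2ⁿm'ℓ)` (`c ≡ a (2ⁿ)`, `c ≡ b (m'ℓ)`, `a`, `b` units) lies in the class `[2ⁿm'c/ℓ] = [2ⁿm'·b̄/ℓ]`
  (`b̄ = b mod ℓ`; `…AddTwistCusp` §1 with `k = 2ⁿm'`, `gcd(2ⁿm', cN) = 1`), and the same for `2·c/(2ⁿm'ℓ)`.
* §2 `exists_sum_filter_jacobi_eq_div_two_mul` — Chinese remainder: a sum over `{b mod m'ℓ : (b | m'ℓ) = ε}` of a function of
  `b mod ℓ` is `N₊·T^{ε} + N₋·T^{−ε}` with `T^δ = Σ_{(r|ℓ)=δ} G(r)`; with `G(r) = [u·r/ℓ]⁺` these are half-character sums, so the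
  character sums of tame symbols at level `m'ℓ` are `j/(2n₁)` with `n₁` ODD (`…AddTwistHalfSums`).
* companion `…AddTwistCongruenceLevel`: `‖Σ_{(b|m'ℓ)=ε} μ_{f,α,m'ℓ}((a + 2ⁿℤ₂) × {b})‖₂ ≤ 2` and the congruence
  `L₂(f,α,χ_{m'ℓ}) ≡ u·L₂(f,α)·∏_{q∣m'}𝒫_q (mod 2Λ)`.

References: [MazurTateTeitelbaum1986Invent] §I.4 (4.2), §I.8, §I.10; [Matsuno2000] Lemma 3.2 (p. 87); [CremonaAlgorithms1997] §2.2, §2.8.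
-/

set_option autoImplicit false
set_option linter.dupNamespace false

noncomputable section

open scoped Classical MatrixGroups ModularForm NumberTheorySymbols

open CongruenceSubgroup Filter Topology PowerSeries
open Literature.NumberTheory.EllipticCurves Literature.NumberTheory.EllipticCurves.ModularForms
open Literature.NumberTheory.EllipticCurves.GreenbergVatsal2000
open Summit.BirchSwinnertonDyer.BirchSwinnertonDyer.Theorems.AlignedTransportAtTwoAddTwistCusp
open Summit.BirchSwinnertonDyer.BirchSwinnertonDyer.Theorems.AlignedTransportAtTwoAddTwistHalfSums
open Summit.BirchSwinnertonDyer.BirchSwinnertonDyer.Theorems.AlignedTransportAtTwoAddTwistTame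

namespace Summit.BirchSwinnertonDyer.BirchSwinnertonDyer.Theorems.AlignedTransportAtTwoAddTwistTameLevel

/-! ## §1 Tame fractions at level `m'·ℓ` -/

section TameFractions

variable {N : ℕ} [NeZero N] (f : CuspForm (Gamma0 N) 2) {ℓ m' : ℕ} [Fact ℓ.Prime] [NeZero m'] [NeZero (m' * ℓ)]

/-- The Chinese-remainder representative of `(a mod 2ⁿ, b mod m)` is ODD when `n ≥ 1` and `a` is a unit (any odd level `m`). [folklore] -/
theorem not_two_dvd_tameRep_level {m : ℕ} [NeZero m] (hm2 : m.Coprime 2) {n : ℕ} (hn : n ≠ 0) {a : ZMod (2 ^ n)}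
    (ha : IsUnit a) (b : ZMod m) : ¬ (2 : ℤ) ∣ (tameRep 2 m n a b : ℤ) := by
  have h := natCast_tameRep_left (m := m) (n := n) Nat.prime_two hm2 a b
  have hu : IsUnit ((tameRep 2 m n a b : ℕ) : ZMod (2 ^ n)) := by rw [h]; exact ha
  have hcop := (ZMod.isUnit_iff_coprime _ _).mp hu
  intro h2
  have h2' : 2 ∣ tameRep 2 m n a b := by exact_mod_cast h2
  have h1 : Nat.Coprime 2 2 :=
    Nat.Coprime.coprime_dvd_left h2' (Nat.Coprime.coprime_dvd_right (dvd_pow_self 2 hn) hcop)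
  norm_num at h1

omit [NeZero m'] in
/-- The Chinese-remainder representative at level `m'ℓ` reduces to `b mod ℓ`, is odd when `n ≥ 1` and `a` is a unit, and is prime to `m'`
when `b` is a unit. [folklore] -/
theorem tameRep_level_spec (hM2 : (m' * ℓ).Coprime 2) (n : ℕ) {a : ZMod (2 ^ n)} (ha : IsUnit a) {b : ZMod (m' * ℓ)} (hb : IsUnit b) :
    (((tameRep 2 (m' * ℓ) n a b : ℕ) : ℤ) : ZMod ℓ) = ((b.val : ℕ) : ZMod ℓ) ∧
      (n = 0 ∨ ¬ (2 : ℤ) ∣ (tameRep 2 (m' * ℓ) n a b : ℤ)) ∧ IsCoprime ((tameRep 2 (m' * ℓ) n a b : ℕ) : ℤ) (m' : ℤ) := by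
  set c := tameRep 2 (m' * ℓ) n a b with hc
  have hcb : (c : ZMod (m' * ℓ)) = b := natCast_tameRep_right hM2 a b
  have hcbℓ : ((c : ℤ) : ZMod ℓ) = ((b.val : ℕ) : ZMod ℓ) := by
    have h1 : (c : ZMod (m' * ℓ)) = ((b.val : ℕ) : ZMod (m' * ℓ)) := by rw [hcb, ZMod.natCast_zmod_val]
    rw [ZMod.natCast_eq_natCast_iff'] at h1
    rw [Int.cast_natCast, ZMod.natCast_eq_natCast_iff']
    exact Nat.ModEq.of_dvd (dvd_mul_left ℓ m') h1
  have hodd : n = 0 ∨ ¬ (2 : ℤ) ∣ (c : ℤ) := by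
    by_cases hn : n = 0
    · exact Or.inl hn
    · exact Or.inr (not_two_dvd_tameRep_level hM2 hn ha b)
  have hcop : IsCoprime (c : ℤ) (m' : ℤ) := by
    have hu : IsUnit ((c : ℕ) : ZMod (m' * ℓ)) := by rw [hcb]; exact hb
    have h := (ZMod.isUnit_iff_coprime c (m' * ℓ)).mp hu
    exact Nat.isCoprime_iff_coprime.mpr (Nat.Coprime.coprime_dvd_right (dvd_mul_right m' ℓ) h)
  exact ⟨hcbℓ, hodd, hcop⟩

omit [NeZero (m' * ℓ)] in
/-- **`[c/(2ᵏm'ℓ)]⁺ = [2ᵏm'·b̄/ℓ]⁺ + j/2` at level `m'ℓ`** (`ℓ² ∣ N`, `N` odd, `gcd(m', N) = 1`, `c ≡ b̄ (mod ℓ)`, `c` prime to `m'`, `c` odd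
unless `k = 0`): `…AddTwistCusp` §2 with `k = 2ᵏm'`. [cite: CremonaAlgorithms1997, §2.2 Lemma 2.2.3 and §2.8] -/
theorem exists_ratPlusSymbol_div_pow_mul_level_eq (hreal : ∀ n, (cuspCoeff f n).im = 0)
    (hrat : ∀ r : ℚ, (ratPlusSymbol f r : ℝ) = normalizedPlusSymbol f r) (hℓN : ℓ ^ 2 ∣ N) (h2N : ¬ 2 ∣ N)
    (hm'N : m'.Coprime N) (k : ℕ) {c : ℤ} (hc : k = 0 ∨ ¬ (2 : ℤ) ∣ c) (hcm' : IsCoprime c (m' : ℤ))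
    {b : ZMod ℓ} (hcb : (c : ZMod ℓ) = b) :
    ∃ j : ℤ, ratPlusSymbol f ((c : ℚ) / (2 ^ k * m' * ℓ)) =
      ratPlusSymbol f ((((2 : ZMod ℓ) ^ k * (m' : ZMod ℓ) * b).val : ℚ) / ℓ) + (j : ℚ) / 2 := by
  have hℓ : ℓ.Prime := Fact.out
  obtain ⟨M', hM'⟩ := hℓN
  have hN : (N : ℤ) = (ℓ : ℤ) * ℓ * M' := by rw [hM']; push_cast; ring
  have hℓ0 : (ℓ : ℤ) ≠ 0 := by exact_mod_cast hℓ.ne_zero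
  have hk0 : ((2 : ℤ) ^ k * m') ≠ 0 := mul_ne_zero (pow_ne_zero _ two_ne_zero) (by exact_mod_cast NeZero.ne m')
  -- `gcd(2ᵏm', c ℓ M') = 1`
  have hN2 : ¬ (2 : ℤ) ∣ (ℓ : ℤ) * M' := by
    intro h'
    apply h2N
    have h'' : (2 : ℤ) ∣ (N : ℤ) := by rw [hN, mul_assoc]; exact h'.mul_left _
    exact_mod_cast h''
  have h2 : IsCoprime ((2 : ℤ) ^ k) (c * ((ℓ : ℤ) * M')) := by
    rcases hc with rfl | hc
    · rw [pow_zero]; exact isCoprime_one_left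
    · refine IsCoprime.pow_left ((Prime.coprime_iff_not_dvd Int.prime_two).mpr fun h ↦ ?_)
      rcases Int.prime_two.dvd_or_dvd h with h1 | h1
      · exact hc h1
      · exact hN2 h1
  have hm'ℓM' : IsCoprime (m' : ℤ) ((ℓ : ℤ) * M') := by
    have h : m'.Coprime (ℓ * M') := Nat.Coprime.coprime_dvd_right (Dvd.intro_left ℓ (by rw [hM']; ring)) hm'N
    exact_mod_cast Nat.isCoprime_iff_coprime.mpr h
  have hcop : IsCoprime ((2 : ℤ) ^ k * m') (c * ((ℓ : ℤ) * M')) :=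
    IsCoprime.mul_left h2 (IsCoprime.mul_right hcm'.symm hm'ℓM')
  obtain ⟨j, hj⟩ := exists_ratPlusSymbol_div_mul_eq_add_div_two f hreal hrat hN hℓ0 hk0 hcop (p := c)
  refine ⟨j, ?_⟩
  have hcl : (((2 : ℤ) ^ k * m' * c : ℤ) : ZMod ℓ) = ((((2 : ZMod ℓ) ^ k * (m' : ZMod ℓ) * b).val : ℤ) : ZMod ℓ) := by
    push_cast
    rw [ZMod.natCast_zmod_val, hcb]
  have h := ratPlusSymbol_div_eq_of_intCast_eq f hℓ.ne_zero hcl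
  push_cast at hj h ⊢
  rw [hj, h]

/-- **The tame fraction at level `m'ℓ` lies in the class `[2ⁿm'·b̄/ℓ]`** (`a`, `b` units, `b̄ = b mod ℓ`).
[cite: MazurTateTeitelbaum1986Invent, §I.10 (10.1)] [cite: CremonaAlgorithms1997, §2.2 Lemma 2.2.3] -/
theorem exists_ratPlusSymbol_tameFraction_level_eq (hreal : ∀ n, (cuspCoeff f n).im = 0)
    (hrat : ∀ r : ℚ, (ratPlusSymbol f r : ℝ) = normalizedPlusSymbol f r) (hℓN : ℓ ^ 2 ∣ N) (h2N : ¬ 2 ∣ N)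
    (hm'N : m'.Coprime N) (hM2 : (m' * ℓ).Coprime 2) (n : ℕ) {a : ZMod (2 ^ n)} (ha : IsUnit a)
    {b : ZMod (m' * ℓ)} (hb : IsUnit b) :
    ∃ j : ℤ, ratPlusSymbol f (tameFraction 2 (m' * ℓ) n a b) =
      ratPlusSymbol f ((((2 : ZMod ℓ) ^ n * (m' : ZMod ℓ) * ((b.val : ℕ) : ZMod ℓ)).val : ℚ) / ℓ) + (j : ℚ) / 2 := by
  obtain ⟨hcb, hc, hcm'⟩ := tameRep_level_spec hM2 n ha hb
  obtain ⟨j, hj⟩ := exists_ratPlusSymbol_div_pow_mul_level_eq f hreal hrat hℓN h2N hm'N n hc hcm' hcb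
  refine ⟨j, ?_⟩
  have hx : tameFraction 2 (m' * ℓ) n a b = ((tameRep 2 (m' * ℓ) n a b : ℤ) : ℚ) / (2 ^ n * m' * ℓ) := by
    unfold tameFraction; push_cast; ring
  rw [hx, hj]

/-- The same for `2 ·` the tame fraction at `n + 1` (class `[2ⁿm'·b̄/ℓ]`). [cite: MazurTateTeitelbaum1986Invent, §I.10 (10.1)] -/
theorem exists_ratPlusSymbol_two_mul_tameFraction_level_succ_eq (hreal : ∀ n, (cuspCoeff f n).im = 0)
    (hrat : ∀ r : ℚ, (ratPlusSymbol f r : ℝ) = normalizedPlusSymbol f r) (hℓN : ℓ ^ 2 ∣ N) (h2N : ¬ 2 ∣ N)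
    (hm'N : m'.Coprime N) (hM2 : (m' * ℓ).Coprime 2) (n : ℕ) {a : ZMod (2 ^ (n + 1))} (ha : IsUnit a)
    {b : ZMod (m' * ℓ)} (hb : IsUnit b) :
    ∃ j : ℤ, ratPlusSymbol f (((2 : ℕ) : ℚ) * tameFraction 2 (m' * ℓ) (n + 1) a b) =
      ratPlusSymbol f ((((2 : ZMod ℓ) ^ n * (m' : ZMod ℓ) * ((b.val : ℕ) : ZMod ℓ)).val : ℚ) / ℓ) + (j : ℚ) / 2 := by
  obtain ⟨hcb, hc, hcm'⟩ := tameRep_level_spec hM2 (n + 1) ha hb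
  have hc' : n = 0 ∨ ¬ (2 : ℤ) ∣ (tameRep 2 (m' * ℓ) (n + 1) a b : ℤ) := by
    rcases hc with h | h
    · exact absurd h (Nat.succ_ne_zero n)
    · exact Or.inr h
  obtain ⟨j, hj⟩ := exists_ratPlusSymbol_div_pow_mul_level_eq f hreal hrat hℓN h2N hm'N n hc' hcm' hcb
  refine ⟨j, ?_⟩
  have hℓQ : (ℓ : ℚ) ≠ 0 := by exact_mod_cast (Fact.out : ℓ.Prime).ne_zero
  have hm'Q : (m' : ℚ) ≠ 0 := by exact_mod_cast NeZero.ne m'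
  have hx : ((2 : ℕ) : ℚ) * tameFraction 2 (m' * ℓ) (n + 1) a b =
      ((tameRep 2 (m' * ℓ) (n + 1) a b : ℤ) : ℚ) / (2 ^ n * m' * ℓ) := by
    unfold tameFraction; push_cast; field_simp; ring
  rw [hx, hj]

/-- The same at `n = 0`: `[2·c/(m'ℓ)]⁺ = [2m'·b̄/ℓ]⁺ + j/2`. [cite: MazurTateTeitelbaum1986Invent, §I.10 (10.1)] -/
theorem exists_ratPlusSymbol_two_mul_tameFraction_level_zero_eq (hreal : ∀ n, (cuspCoeff f n).im = 0)
    (hrat : ∀ r : ℚ, (ratPlusSymbol f r : ℝ) = normalizedPlusSymbol f r) (hℓN : ℓ ^ 2 ∣ N) (h2N : ¬ 2 ∣ N)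
    (hm'N : m'.Coprime N) (hM2 : (m' * ℓ).Coprime 2) (a : ZMod (2 ^ 0)) {b : ZMod (m' * ℓ)} (hb : IsUnit b) :
    ∃ j : ℤ, ratPlusSymbol f (((2 : ℕ) : ℚ) * tameFraction 2 (m' * ℓ) 0 a b) =
      ratPlusSymbol f ((((2 : ZMod ℓ) * (m' : ZMod ℓ) * ((b.val : ℕ) : ZMod ℓ)).val : ℚ) / ℓ) + (j : ℚ) / 2 := by
  haveI : Subsingleton (ZMod (2 ^ 0)) := by rw [pow_zero]; infer_instance
  obtain ⟨hcb, -, hcm'⟩ := tameRep_level_spec hM2 0 (isUnit_of_subsingleton a) hb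
  have hcb2 : ((2 * (tameRep 2 (m' * ℓ) 0 a b : ℤ) : ℤ) : ZMod ℓ) = (2 : ZMod ℓ) * ((b.val : ℕ) : ZMod ℓ) := by
    rw [Int.cast_mul, hcb]; push_cast; rfl
  have hcm'2 : IsCoprime (2 * (tameRep 2 (m' * ℓ) 0 a b : ℤ)) (m' : ℤ) := by
    refine IsCoprime.mul_left ?_ hcm'
    have h : m'.Coprime 2 := Nat.Coprime.coprime_dvd_left (dvd_mul_right m' ℓ) hM2
    exact (Nat.isCoprime_iff_coprime.mpr h).symm
  obtain ⟨j, hj⟩ := exists_ratPlusSymbol_div_pow_mul_level_eq f hreal hrat hℓN h2N hm'N 0 (Or.inl rfl) hcm'2 hcb2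
  refine ⟨j, ?_⟩
  have hx : ((2 : ℕ) : ℚ) * tameFraction 2 (m' * ℓ) 0 a b =
      ((2 * (tameRep 2 (m' * ℓ) 0 a b : ℤ) : ℤ) : ℚ) / (2 ^ 0 * m' * ℓ) := by
    unfold tameFraction; push_cast; ring
  have e : (2 : ZMod ℓ) ^ 0 * (m' : ZMod ℓ) * ((2 : ZMod ℓ) * ((b.val : ℕ) : ZMod ℓ)) =
      2 * (m' : ZMod ℓ) * ((b.val : ℕ) : ZMod ℓ) := by ring
  rw [e] at hj
  rw [hx, hj]

end TameFractions

/-! ## §2 Character sums at level `m'·ℓ` through the Chinese remainder theorem -/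

section CRT

variable {N : ℕ} [NeZero N] (f : CuspForm (Gamma0 N) 2) {ℓ m' : ℕ} [Fact ℓ.Prime] [NeZero m'] [NeZero (m' * ℓ)]

omit [NeZero N] in
/-- Summing fractions with a common denominator: if `g i = k_i/D` termwise then `Σ g = k/D`. [folklore] -/
theorem exists_sum_eq_intCast_div {ι : Type*} (s : Finset ι) {g : ι → ℚ} {D : ℚ}
    (h : ∀ i ∈ s, ∃ k : ℤ, g i = (k : ℚ) / D) : ∃ k : ℤ, ∑ i ∈ s, g i = (k : ℚ) / D := by
  classical
  induction s using Finset.induction_on with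
  | empty => exact ⟨0, by simp⟩
  | insert a s ha ih =>
    obtain ⟨k₁, hk₁⟩ := h a (Finset.mem_insert_self a s)
    obtain ⟨k₂, hk₂⟩ := ih fun i hi ↦ h i (Finset.mem_insert_of_mem hi)
    refine ⟨k₁ + k₂, ?_⟩
    rw [Finset.sum_insert ha, hk₁, hk₂]
    push_cast
    ring

omit [NeZero N] in
/-- **Chinese remainder for Jacobi-character sums**: for `gcd(m', ℓ) = 1` and `ε ≠ 0`, a sum over `{b mod m'ℓ : (b | m'ℓ) = ε}` of a
function of `b mod ℓ` splits as `Σ_{s mod m'} [ (s|m') = ±1 ] · Σ_{(r|ℓ) = ±ε} G(r)`: each term of the outer sum is `0`, `T^{ε}` or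
`T^{−ε}` with `T^δ = Σ_{r : (r|ℓ) = δ} G(r)`. Stated as: if `T^{ε} = j₁/D` and `T^{−ε} = j₂/D` then the whole sum is `k/D`.
[cite: MazurTateTeitelbaum1986Invent, §I.8] -/
theorem exists_sum_filter_jacobi_level_eq_div (hcop : m'.Coprime ℓ) (G : ZMod ℓ → ℚ) {ε : ℤ} (hε : ε = 1 ∨ ε = -1)
    {D : ℚ} (hT : ∀ δ : ℤ, δ = 1 ∨ δ = -1 → ∃ k : ℤ,
      ∑ r ∈ Finset.univ.filter (fun r : ZMod ℓ ↦ J((r.val : ℤ) | ℓ) = δ), G r = (k : ℚ) / D) :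
    ∃ k : ℤ, ∑ b ∈ Finset.univ.filter (fun b : ZMod (m' * ℓ) ↦ J((b.val : ℤ) | m' * ℓ) = ε),
      G ((b.val : ℕ) : ZMod ℓ) = (k : ℚ) / D := by
  set e := ZMod.chineseRemainder hcop with he
  -- the summand as a function on `ZMod m' × ZMod ℓ`
  set F : ZMod m' × ZMod ℓ → ℚ := fun x ↦
    if J((x.1.val : ℤ) | m') * J((x.2.val : ℤ) | ℓ) = ε then G x.2 else 0 with hF
  have hcomp : ∀ b : ZMod (m' * ℓ), (e b).1 = ((b.val : ℕ) : ZMod m') ∧ (e b).2 = ((b.val : ℕ) : ZMod ℓ) := by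
    intro b
    have heb : e b = (ZMod.cast b : ZMod m' × ZMod ℓ) := rfl
    rw [heb, Prod.fst_zmod_cast, Prod.snd_zmod_cast, ZMod.cast_eq_val, ZMod.cast_eq_val]
    exact ⟨rfl, rfl⟩
  have hJ : ∀ b : ZMod (m' * ℓ), J((b.val : ℤ) | m' * ℓ) =
      J(((((b.val : ℕ) : ZMod m')).val : ℤ) | m') * J(((((b.val : ℕ) : ZMod ℓ)).val : ℤ) | ℓ) := by
    intro b
    rw [jacobiSym.mul_right, ZMod.val_natCast, ZMod.val_natCast, jacobiSym.mod_left (b.val : ℤ) m',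
      jacobiSym.mod_left (b.val : ℤ) ℓ]
    push_cast
    rfl
  have hsum : ∑ b ∈ Finset.univ.filter (fun b : ZMod (m' * ℓ) ↦ J((b.val : ℤ) | m' * ℓ) = ε),
      G ((b.val : ℕ) : ZMod ℓ) = ∑ x : ZMod m' × ZMod ℓ, F x := by
    rw [Finset.sum_filter]
    refine Fintype.sum_equiv e.toEquiv _ _ fun b ↦ ?_
    simp only [hF, RingEquiv.toEquiv_eq_coe, EquivLike.coe_coe]
    rw [(hcomp b).1, (hcomp b).2, hJ b]
  rw [hsum, Fintype.sum_prod_type]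
  refine exists_sum_eq_intCast_div Finset.univ fun s _ ↦ ?_
  -- the inner sum is `0`, `T^{ε}` or `T^{−ε}`
  rcases jacobiSym.trichotomy (s.val : ℤ) m' with h0 | h1 | h1
  · refine ⟨0, ?_⟩
    simp only [hF, h0, zero_mul]
    rw [Finset.sum_ite, Finset.sum_const_zero, add_zero, Finset.sum_eq_zero (fun r hr ↦ ?_), Int.cast_zero, zero_div]
    rw [Finset.mem_filter] at hr
    rcases hε with h | h <;> rw [h] at hr <;> norm_num at hr
  · obtain ⟨k, hk⟩ := hT ε hε
    refine ⟨k, ?_⟩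
    simp only [hF, h1, one_mul]
    rw [← Finset.sum_filter, hk]
  · obtain ⟨k, hk⟩ := hT (-ε) (by rcases hε with h | h <;> simp [h])
    refine ⟨k, ?_⟩
    simp only [hF, h1, neg_one_mul]
    have hiff : ∀ r : ZMod ℓ, (-J((r.val : ℤ) | ℓ) = ε) ↔ (J((r.val : ℤ) | ℓ) = -ε) := fun r ↦ by
      constructor <;> intro h <;> linarith
    simp_rw [hiff]
    rw [← Finset.sum_filter, hk]

/-- **The character sums of the tame symbols at level `m'ℓ` are `j/(2n₁)` with `n₁` ODD**: for the newform `f` (`ℓ² ∣ N`, `a_ℓ(f) = 0`,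
`gcd(m', N) = 1`), a unit `u` of `ℤ/ℓ` and one odd prime `q ∤ N` with `a_q − q − 1` odd,
`Σ_{(b|m'ℓ)=ε} [u·b̄/ℓ]⁺ = k/(2n₁)` (`…AddTwistHalfSums` on each fibre of `b ↦ b mod m'`). [cite: MazurTateTeitelbaum1986Invent, §I.8]
[cite: Matsuno2000, Lemma 3.2 (p. 87)] -/
theorem exists_sum_filter_jacobi_level_ratPlusSymbol_eq (hf : IsNewform0 f) (hreal : ∀ n, (cuspCoeff f n).im = 0)
    (hrat : ∀ r : ℚ, (ratPlusSymbol f r : ℝ) = normalizedPlusSymbol f r)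
    (hℓN : ℓ ^ 2 ∣ N) (haℓ : cuspCoeff f ℓ = 0) {q : ℕ} [Fact q.Prime] (hqN : ¬ q ∣ N) {aq : ℤ}
    (haq : cuspCoeff f q = aq) (hodd : ¬ (2 : ℤ) ∣ aq - q - 1) (hcop : m'.Coprime ℓ) {u : ZMod ℓ} (hu : u ≠ 0)
    {ε : ℤ} (hε : ε = 1 ∨ ε = -1) :
    ∃ n₁ k : ℤ, ¬ (2 : ℤ) ∣ n₁ ∧ ∑ b ∈ Finset.univ.filter (fun b : ZMod (m' * ℓ) ↦ J((b.val : ℤ) | m' * ℓ) = ε),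
      ratPlusSymbol f (((u * ((b.val : ℕ) : ZMod ℓ)).val : ℚ) / ℓ) = (k : ℚ) / (2 * n₁) := by
  obtain ⟨χ, hχ⟩ := exists_mulChar_int_eq_jacobiSym ℓ
  -- the two half-character sums, with a common odd denominator
  have hH : ∀ δ : ℤ, δ = 1 ∨ δ = -1 → ∃ n₁ k : ℤ, ¬ (2 : ℤ) ∣ n₁ ∧
      ∑ r ∈ Finset.univ.filter (fun r : ZMod ℓ ↦ J((r.val : ℤ) | ℓ) = δ), ratPlusSymbol f (((u * r).val : ℚ) / ℓ) =
        (k : ℚ) / (2 * n₁) := by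
    intro δ hδ
    have hfilt : Finset.univ.filter (fun r : ZMod ℓ ↦ J((r.val : ℤ) | ℓ) = δ) =
        Finset.univ.filter (fun r : ZMod ℓ ↦ χ r = δ) := by
      ext r; simp [hχ]
    rw [hfilt, sum_filter_mul_eq χ hu (fun r ↦ ratPlusSymbol f ((r.val : ℚ) / ℓ)) δ]
    have hδ' : χ u * δ = 1 ∨ χ u * δ = -1 := by
      rcases mulChar_apply_eq_one_or_eq_neg_one χ hu with h | h <;> rcases hδ with h' | h' <;> simp [h, h']
    exact exists_sum_filter_ratPlusSymbol_div_eq_div_two_mul f hf hreal hrat hℓN haℓ hqN haq hodd χ hδ'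
  obtain ⟨n₁, k₁, hn₁, h₁⟩ := hH ε hε
  obtain ⟨n₂, k₂, hn₂, h₂⟩ := hH (-ε) (by rcases hε with h | h <;> simp [h])
  have hn₁0 : (n₁ : ℚ) ≠ 0 := by exact_mod_cast (show n₁ ≠ 0 by rintro rfl; exact hn₁ (dvd_zero 2))
  have hn₂0 : (n₂ : ℚ) ≠ 0 := by exact_mod_cast (show n₂ ≠ 0 by rintro rfl; exact hn₂ (dvd_zero 2))
  refine ⟨n₁ * n₂, ?_⟩
  have hodd12 : ¬ (2 : ℤ) ∣ n₁ * n₂ := fun h ↦ by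
    rcases Int.prime_two.dvd_or_dvd h with h | h
    · exact hn₁ h
    · exact hn₂ h
  obtain ⟨k, hk⟩ := exists_sum_filter_jacobi_level_eq_div hcop (fun r ↦ ratPlusSymbol f (((u * r).val : ℚ) / ℓ)) hε
    (D := 2 * ((n₁ * n₂ : ℤ) : ℚ)) (fun δ hδ ↦ by
      have h2n₁ : (2 : ℚ) * n₁ ≠ 0 := mul_ne_zero two_ne_zero hn₁0
      have h2n₂ : (2 : ℚ) * n₂ ≠ 0 := mul_ne_zero two_ne_zero hn₂0
      have h2n : (2 : ℚ) * (n₁ * n₂) ≠ 0 := mul_ne_zero two_ne_zero (mul_ne_zero hn₁0 hn₂0)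
      by_cases hδε : δ = ε
      · subst hδε
        refine ⟨k₁ * n₂, ?_⟩
        rw [h₁]; push_cast
        rw [div_eq_div_iff h2n₁ h2n]; ring
      · have hδε' : δ = -ε := by
          rcases hδ with rfl | rfl <;> rcases hε with h | h <;> subst h <;> simp_all
        subst hδε'
        refine ⟨k₂ * n₁, ?_⟩
        rw [h₂]; push_cast
        rw [div_eq_div_iff h2n₂ h2n]; ring)
  exact ⟨k, hodd12, by rw [hk]⟩

end CRT

end Summit.BirchSwinnertonDyer.BirchSwinnertonDyer.Theorems.AlignedTransportAtTwoAddTwistTameLevel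

end
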